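import Summits.ABC.IUTFork.Repair.RHSigmaStrataEqPilotGap
import HarnessLib

/-!
# R-H ROUND 2, Q1′ (i)/(ii) — LICENCE-MASS BOOKKEEPING over any verbatim setting: the trivial cost of a cell, the off-Σ / on-Σ trivial mass
# `B_triv(σᶜ)` / `mass(σ)`, the total `M`, the THRESHOLD `T := M − tol`, «S on Σ ⟹ Cor. 3.12 weakened by `B_triv(σᶜ)`», and the
# NO-INTERIOR lower bound «one off-Σ cell already costs its whole `(j²−1)`-weight»

Bookkeeping + proof file of the abc-iut cell, rung LADDER-ABC:A2.RESCUE.H, R-H ROUND 2 Q1′ (human question relayed by 21-frontier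
2026-08-26T22:12:42Z «what is the MINIMUM Σ that would still imply abc (with worse constant)?»; director-abc g3 22:18:18Z items (i)/(ii); rh-lead g2
22:41:51Z and MIN-SLICE.md v0.5 §(i)/(ii)). Seat abc-iut-rh2-T-1 (threshold typer); the generic half — its datum-level regimes and the `ABC` endpoint
are the companions `Conditional/AbcOfSigmaMassDisplay.lean`, `Conditional/AbcOfSigmaMass.lean`. Composed BY NAME from abc-iut-rh2-q2-eq's ACCEPTED
`RH.SigmaLicence` (p468453: `LicenceOn`, `offRemainder`, `offImageGap`, `StatementUpTo`, `offRemainder_le_offImageGap`,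
`statementUpTo_of_licenceOn_of_offRemainder_le`) and `RH.SigmaStrataEq` (p472500: `imageGap_thetaRegion3_inr/_inl`); nothing re-typed.

WHAT IS TYPED (cells `c = (i, v_ℚ)`, label `j = i+1 ∈ 𝔽_l^⋇`; `PN` = procession average over `j`, weight `1/l⋇`; ANY `P : Cor312.Setting S`, ANY cell set `σ`):
* §1 `cellTrivialCost P c := (qLocal_c − logvol(Θ-region³_c))⁺` — what DISCARDING the cell costs when only the trivial inclusion «Θ-region ⊆ hull» is
  used (MIN-SLICE (i)'s `t_triv = c(w,j)·(j²−1)·m_q(w)` summed over `w | p`); `offTrivialMass P σ := PN Σᶠ 1_{σᶜ}·cost` (**`B_triv(σᶜ)`**, `=` q2-eq's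
  `offImageGap` along the Θ-regions, `rfl`); `onTrivialMass P σ` (**`mass(σ)`**, the director's «Σ-mass»); `totalTrivialMass P` (**`M`**);
  **`massThreshold P tol := M − tol`** (**`T`**). PROVED: `onTrivialMass_add_offTrivialMass` (`mass(σ) + B_triv(σᶜ) = M`),
  **`massThreshold_le_onTrivialMass_iff`** (`T ≤ mass(σ) ⟺ B_triv(σᶜ) ≤ tol` — «Σ-mass ≥ T» IS «off-Σ trivial cost within the tolerance»),
  `offRemainder_le_offTrivialMass`, **`statementUpTo_offTrivialMass_of_licenceOn`** (bridge hypotheses ∧ `LicenceOn P σ` ⟹ `−|log(q)| ≤ −|log(Θ)| + B_triv(σᶜ)`),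
  `statementUpTo_of_licenceOn_of_massThreshold_le` (threshold form), antitonicity / the two ends `σ = ∅` (`B_triv = M`), `σ = univ` (`B_triv = 0`), and the
  NO-INTERIOR lower bound **`cellTrivialCost_div_le_offTrivialMass`**: a SINGLE cell `c ∉ σ` forces `B_triv(σᶜ) ≥ cost(c)/l⋇`, so `B_triv(σᶜ) ≤ tol` makes `σ`
  contain EVERY cell with `cost(c) > l⋇·tol` (`mem_of_offTrivialMass_le_of_lt_cost`, `mem_of_massThreshold_le_of_lt_cost`; rh2-q3-num 2026-08-26T23:13:02Z
  «the knapsack has no interior solution», kernel form).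
* §2 AT THE GENUINE BED (abc-iut-c312-7's sharp print-normalised setting of any Dupuy–Hilado pilot datum, REALISING ideles):
  `cellTrivialCost_settingPrVolSharp_eq` — the cost of the prime cell `(i, p)` is `((i+1)² − 1)·(−qLocal_{i+1,p})`, of an archimedean cell `0`; so
  `B_triv(σᶜ) = (1/l⋇)·Σ_{(j,p)∉σ}(j²−1)·|qLocal_p|`, the number MIN-SLICE (i)/(iii) tabulates (q2-eq `offRemainder_le_offPilotGap` is this bound unnamed).
The identification `M = (κ−1)·|−|log(q)||` (`κ = l(l+1)/12`) and its comparison with `T.gap` are abc-iut-rh2-w-1's item (i), not restated here.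
HONEST FRAMING: nothing here asserts that abc is proved or refuted, or that [IUTchIII] Cor. 3.12 holds or fails at any datum, or takes a side on any author
(Mochizuki / Scholze–Stix / Joshi / Dupuy–Hilado); `LicenceOn` is a READING PREDICATE about OUR typed hull, never asserted; typed ≠ proved; instantiated ≠ endorsed.
[cite: Mochizuki2012, IUTchIII Cor. 3.12 p. 173–174, Step (xi-f) p. 184, Prop. 3.9 (i)(iii) p. 116–117; IUTchI Ex. 3.2 (iv) p. 71] [cite: ScholzeStix2018, §2.2 p. 10]
[cite: DupuyHilado2025, §3.3, §3.9, Thm. 3.10.1] [claim: Mochizuki2012, status: disputed] for every IUT locution. Axioms: standard.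
-/

noncomputable section

open Set Function NumberField IsDedekindDomain

namespace Summit.ABC.IUTFork.Repair.RH.SigmaMass

open Summit.ABC.IUTFork.Thm311 Summit.ABC.IUTFork.Thm311.Real Summit.ABC.IUTFork.Cor312 Summit.ABC.IUTFork.Cor312.Setting
  Summit.ABC.IUTFork.Cor312Vol Summit.ABC.IUTFork.Cor312Prov Literature.IUT.LogThetaLattice Literature.IUT.LogVolume
  Literature.IUT.HodgeTheaters Literature.IUT.LogVolume.ThetaData
  Summit.ABC.IUTFork.Repair.RH.SigmaLicence Summit.ABC.IUTFork.Repair.RH.SigmaStrataEq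

/-! ## §1. Generic: trivial costs, on-Σ / off-Σ mass, the threshold, and the no-interior lower bound -/

section Generic

variable {ι : ThetaIndex} {S : Situation ι} (P : Cor312.Setting S)

/-- **The trivial cost of a cell** `c = (i, v_ℚ)`: `(qLocal_{i+1,v_ℚ} − logvol(Θ-region³_{i+1,v_ℚ}))⁺` — the q-pilot log-volume minus the log-volume of
the (Ind3)-enlarged Θ-pilot region, positive part. Since the Θ-region is a possible image and lies in the hull ⁿ˒°𝒰, this is what the cell's
deficit costs AT MOST when the licence is not available there (q2-eq `cellDeficit_le_qLocal_sub_image`); at a prime cell of the genuine bed it is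
`((i+1)² − 1)·|qLocal_{i+1,p}|` (q2-eq `imageGap_thetaRegion3_inr`), i.e. MIN-SLICE (i)'s `t_triv = c(w,j)·(j²−1)·m_q(w)` summed over `w | p`.
[cite: DupuyHilado2025, §3.3, §3.9] [claim: Mochizuki2012, status: disputed] -/
@[claim "Mochizuki2012" "disputed"]
def cellTrivialCost (c : Fin ι.lstar × ι.VQ) : ℝ :=
  max (P.qLocal (labelSucc c.1) c.2 - (S.D P.n).logvol (labelSucc c.1) c.2 (P.thetaRegion3 (labelSucc c.1) c.2)) 0

/-- **`B_triv(σᶜ)` — the off-Σ trivial mass**: `PN(i ↦ Σᶠ_{v_ℚ} 1_{σᶜ}(i,v_ℚ)·cost(i,v_ℚ))`, the procession-normalised total trivial cost of the cells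
DISCARDED by the stratum `σ` (= q2-eq's `offImageGap P σ U_Θ` along the Θ-regions, `offTrivialMass_eq_offImageGap`). [claim: Mochizuki2012, status: disputed] -/
@[claim "Mochizuki2012" "disputed"]
def offTrivialMass (σ : Set (Fin ι.lstar × ι.VQ)) : ℝ :=
  processionNormalized fun i : Fin ι.lstar => ∑ᶠ vQ : ι.VQ, σᶜ.indicator (cellTrivialCost P) (i, vQ)

/-- **`mass(σ)` — the on-Σ trivial mass**: `PN(i ↦ Σᶠ_{v_ℚ} 1_σ(i,v_ℚ)·cost(i,v_ℚ))`, the trivial cost RETAINED by the stratum (the director's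
«Σ-mass Σ_Σ c(w,j)»). [claim: Mochizuki2012, status: disputed] -/
@[claim "Mochizuki2012" "disputed"]
def onTrivialMass (σ : Set (Fin ι.lstar × ι.VQ)) : ℝ :=
  processionNormalized fun i : Fin ι.lstar => ∑ᶠ vQ : ι.VQ, σ.indicator (cellTrivialCost P) (i, vQ)

/-- **`M` — the total trivial mass** of the setting: `PN(i ↦ Σᶠ_{v_ℚ} cost(i,v_ℚ))` (all cells discarded; at the genuine bed the full Θ/q pilot gap
`(κ−1)·|−|log(q)||`, `κ = l(l+1)/12` — MIN-SLICE (i), abc-iut-rh2-w-1's closed form). [claim: Mochizuki2012, status: disputed] -/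
@[claim "Mochizuki2012" "disputed"]
def totalTrivialMass : ℝ :=
  processionNormalized fun i : Fin ι.lstar => ∑ᶠ vQ : ι.VQ, cellTrivialCost P (i, vQ)

/-- **`T` — THE LICENCE-MASS THRESHOLD for a tolerance `tol`**: `massThreshold P tol := M − tol`. READING (MIN-SLICE (ii)): «S on Σ ⟹ abc with the
constant attached to `tol`» exactly when `mass(σ) ≥ massThreshold P tol` (`massThreshold_le_onTrivialMass_iff`); with `tol := Tol(P,l)` of
abc-iut-rh2-q2-cond no constant moves, with `tol := Tol + s` the shift of §2 (R1). [claim: Mochizuki2012, status: disputed] -/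
@[claim "Mochizuki2012" "disputed"]
def massThreshold (tol : ℝ) : ℝ :=
  totalTrivialMass P - tol

/-- The Θ-regions as a global choice of possible images (identity indeterminacy in every packet; q2-eq / c312-6 `imageChoice_nonempty`). [folklore] -/
def thetaImageChoice : ImageChoice P :=
  ⟨fun c => P.thetaRegion3 _ c.2, fun c => P.thetaRegion3_mem_possibleImages _ c.2⟩

variable {P}

/-- The trivial cost of a cell is non-negative. [folklore] -/
theorem cellTrivialCost_nonneg (c : Fin ι.lstar × ι.VQ) : 0 ≤ cellTrivialCost P c :=
  le_max_right _ _

/-- `B_triv(σᶜ)` IS q2-eq's off-Σ image gap along the Θ-regions (definitional). [folklore] -/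
theorem offTrivialMass_eq_offImageGap (σ : Set (Fin ι.lstar × ι.VQ)) :
    offTrivialMass P σ = offImageGap P σ (thetaImageChoice P) :=
  rfl

/-- **`R_σ ≤ B_triv(σᶜ)`**: the off-Σ remainder of the hull is at most the off-Σ trivial mass (q2-eq `offRemainder_le_offImageGap` with the Θ-regions).
[claim: Mochizuki2012, status: disputed] -/
theorem offRemainder_le_offTrivialMass (H : BridgeHyps P) (σ : Set (Fin ι.lstar × ι.VQ)) :
    offRemainder P σ ≤ offTrivialMass P σ := by
  rw [offTrivialMass_eq_offImageGap]
  exact offRemainder_le_offImageGap H σ _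

/-- **«S on Σ ⟹ Cor. 3.12 WEAKENED BY THE OFF-Σ TRIVIAL MASS»**: under the bridge hypotheses, the licence on `σ` alone gives
`−|log(Θ)| ∈ ℝ ∧ −|log(q)| ≤ −|log(Θ)| + B_triv(σᶜ)` (q2-eq `statementUpTo_of_licenceOn_of_offRemainder_le` ∘ `offRemainder_le_offTrivialMass`).
[cite: Mochizuki2012, IUTchIII Cor. 3.12 p. 173–174] [claim: Mochizuki2012, status: disputed] -/
theorem statementUpTo_offTrivialMass_of_licenceOn (H : BridgeHyps P) {σ : Set (Fin ι.lstar × ι.VQ)} (hσ : LicenceOn P σ) :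
    StatementUpTo P (offTrivialMass P σ) :=
  statementUpTo_of_licenceOn_of_offRemainder_le H hσ (offRemainder_le_offTrivialMass H σ)

/-- Per label, the trivial cost is finitely supported over `v_ℚ` (bridge hypotheses: finite support of the image log-volumes). [folklore] -/
theorem cellTrivialCost_support_finite (H : BridgeHyps P) (i : Fin ι.lstar) :
    (Function.support fun vQ : ι.VQ => cellTrivialCost P (i, vQ)).Finite := by
  refine (indicator_imageGap_support_finite H ∅ (thetaImageChoice P) i).subset fun vQ hv => ?_
  rw [Function.mem_support] at hv ⊢
  rw [Set.compl_empty, Set.indicator_of_mem (Set.mem_univ _)]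
  exact hv

/-- Per label, the indicator-weighted trivial cost is finitely supported over `v_ℚ`. [folklore] -/
theorem indicator_cellTrivialCost_support_finite (H : BridgeHyps P) (σ : Set (Fin ι.lstar × ι.VQ)) (i : Fin ι.lstar) :
    (Function.support fun vQ : ι.VQ => σ.indicator (cellTrivialCost P) (i, vQ)).Finite := by
  refine (cellTrivialCost_support_finite H i).subset fun vQ hv => ?_
  rw [Function.mem_support] at hv ⊢
  intro h0
  exact hv (Set.indicator_apply_eq_zero.2 fun _ => h0)

/-- `B_triv(σᶜ) ≥ 0`. [folklore] -/
theorem offTrivialMass_nonneg (σ : Set (Fin ι.lstar × ι.VQ)) : 0 ≤ offTrivialMass P σ :=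
  processionNormalized_nonneg fun _ => finsum_nonneg fun _ => Set.indicator_nonneg (fun _ _ => cellTrivialCost_nonneg _) _

/-- `mass(σ) ≥ 0`. [folklore] -/
theorem onTrivialMass_nonneg (σ : Set (Fin ι.lstar × ι.VQ)) : 0 ≤ onTrivialMass P σ :=
  processionNormalized_nonneg fun _ => finsum_nonneg fun _ => Set.indicator_nonneg (fun _ _ => cellTrivialCost_nonneg _) _

/-- `M ≥ 0`. [folklore] -/
theorem totalTrivialMass_nonneg : 0 ≤ totalTrivialMass P :=
  processionNormalized_nonneg fun _ => finsum_nonneg fun _ => cellTrivialCost_nonneg _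

/-- **`mass(σ) + B_triv(σᶜ) = M`**: the retained and the discarded trivial mass add up to the total (cell by cell `1_σ + 1_{σᶜ} = 1`; finite supports
from the bridge hypotheses). [folklore] -/
theorem onTrivialMass_add_offTrivialMass (H : BridgeHyps P) (σ : Set (Fin ι.lstar × ι.VQ)) :
    onTrivialMass P σ + offTrivialMass P σ = totalTrivialMass P := by
  unfold onTrivialMass offTrivialMass totalTrivialMass processionNormalized
  rw [← add_div, ← Finset.sum_add_distrib]
  congr 1
  refine Finset.sum_congr rfl fun i _ => ?_
  rw [← finsum_add_distrib (indicator_cellTrivialCost_support_finite H σ i) (indicator_cellTrivialCost_support_finite H σᶜ i)]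
  exact finsum_congr fun vQ => Set.indicator_self_add_compl_apply σ (cellTrivialCost P) (i, vQ)

/-- `B_triv(∅ᶜ) = M`: discarding every cell costs the total mass. [folklore] -/
theorem offTrivialMass_empty : offTrivialMass P ∅ = totalTrivialMass P := by
  unfold offTrivialMass totalTrivialMass
  simp only [Set.compl_empty, Set.indicator_univ]

/-- `B_triv(univᶜ) = 0`: keeping every cell costs nothing. [folklore] -/
theorem offTrivialMass_univ : offTrivialMass P Set.univ = 0 := by
  unfold offTrivialMass
  simp only [Set.compl_univ, Set.indicator_empty, finsum_zero]
  exact processionNormalized_zero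

/-- `B_triv` is ANTITONE in the stratum: enlarging `σ` can only lower the discarded mass. [folklore] -/
theorem offTrivialMass_anti (H : BridgeHyps P) {σ σ' : Set (Fin ι.lstar × ι.VQ)} (h : σ ⊆ σ') :
    offTrivialMass P σ' ≤ offTrivialMass P σ := by
  unfold offTrivialMass processionNormalized
  refine div_le_div_of_nonneg_right (Finset.sum_le_sum fun i _ => ?_) (Nat.cast_nonneg _)
  refine finsum_le_finsum' (indicator_cellTrivialCost_support_finite H σ'ᶜ i) (indicator_cellTrivialCost_support_finite H σᶜ i)
    fun vQ => ?_
  exact Set.indicator_le_indicator_of_subset (Set.compl_subset_compl.mpr h) (fun _ => cellTrivialCost_nonneg _) _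

/-- **THE THRESHOLD READING: `T ≤ mass(σ) ⟺ B_triv(σᶜ) ≤ tol`** (`T = massThreshold P tol = M − tol`). The director's «S on Σ ⟹ nontrivial abc iff
Σ-mass ≥ T» and the typer's «off-Σ trivial cost within the tolerance» are ONE condition. [folklore] -/
theorem massThreshold_le_onTrivialMass_iff (H : BridgeHyps P) (σ : Set (Fin ι.lstar × ι.VQ)) (tol : ℝ) :
    massThreshold P tol ≤ onTrivialMass P σ ↔ offTrivialMass P σ ≤ tol := by
  unfold massThreshold
  rw [← onTrivialMass_add_offTrivialMass H σ]
  constructor <;> intro h <;> linarith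

/-- **«S on Σ with `mass(σ) ≥ T` ⟹ Cor. 3.12 weakened by `tol`»** (threshold form of `statementUpTo_offTrivialMass_of_licenceOn`).
[cite: Mochizuki2012, IUTchIII Cor. 3.12 p. 173–174] [claim: Mochizuki2012, status: disputed] -/
theorem statementUpTo_of_licenceOn_of_massThreshold_le (H : BridgeHyps P) {σ : Set (Fin ι.lstar × ι.VQ)} (hσ : LicenceOn P σ) {tol : ℝ}
    (hT : massThreshold P tol ≤ onTrivialMass P σ) : StatementUpTo P tol :=
  statementUpTo_mono ((massThreshold_le_onTrivialMass_iff H σ tol).mp hT) (statementUpTo_offTrivialMass_of_licenceOn H hσ)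

/-- **NO INTERIOR SOLUTION (cell form): a single cell `c ∉ σ` already forces `B_triv(σᶜ) ≥ cost(c)/l⋇`** — the off-Σ mass is a sum of non-negative
terms, one of which is the `1/l⋇`-weighted cost of `c`. So `B_triv(σᶜ) ≤ tol` makes `σ` contain every cell of cost `> l⋇·tol`
(`mem_of_offTrivialMass_le_of_lt_cost`): for a prime cell `(j, p)` of the genuine bed `cost = (j²−1)·|qLocal_p|` against `l⋇·Tol(P,l) ≈ 1.7·10⁶·d_mod·l²·l⋇`
(MIN-SLICE (iv), rh2-q3-num 23:13:02Z). [folklore] -/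
theorem cellTrivialCost_div_le_offTrivialMass (H : BridgeHyps P) {σ : Set (Fin ι.lstar × ι.VQ)} {c : Fin ι.lstar × ι.VQ} (hc : c ∉ σ) :
    cellTrivialCost P c / ι.lstar ≤ offTrivialMass P σ := by
  unfold offTrivialMass processionNormalized
  refine div_le_div_of_nonneg_right ?_ (Nat.cast_nonneg _)
  have h1 : cellTrivialCost P c ≤ ∑ᶠ vQ : ι.VQ, σᶜ.indicator (cellTrivialCost P) (c.1, vQ) := by
    have h := single_le_finsum c.2 (indicator_cellTrivialCost_support_finite H σᶜ c.1)
      (fun vQ => Set.indicator_nonneg (fun _ _ => cellTrivialCost_nonneg _) _)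
    rwa [Set.indicator_of_mem (Set.mem_compl hc)] at h
  refine h1.trans ?_
  exact Finset.single_le_sum (f := fun i : Fin ι.lstar => ∑ᶠ vQ : ι.VQ, σᶜ.indicator (cellTrivialCost P) (i, vQ))
    (fun i _ => finsum_nonneg fun _ => Set.indicator_nonneg (fun _ _ => cellTrivialCost_nonneg _) _) (Finset.mem_univ c.1)

/-- **… hence a stratum within tolerance contains every expensive cell**: `B_triv(σᶜ) ≤ tol` and `l⋇·tol < cost(c)` ⟹ `c ∈ σ`. [folklore] -/
theorem mem_of_offTrivialMass_le_of_lt_cost (H : BridgeHyps P) {σ : Set (Fin ι.lstar × ι.VQ)} {tol : ℝ} (hσ : offTrivialMass P σ ≤ tol)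
    {c : Fin ι.lstar × ι.VQ} (hc : (ι.lstar : ℝ) * tol < cellTrivialCost P c) : c ∈ σ := by
  by_contra hn
  have h := cellTrivialCost_div_le_offTrivialMass H hn
  have hl : (0 : ℝ) < ι.lstar := by exact_mod_cast lt_of_lt_of_le (by norm_num) ι.two_le_lstar
  rw [div_le_iff₀ hl] at h
  nlinarith

/-- Threshold form of the same: `T ≤ mass(σ)` ⟹ `σ` contains every cell of cost `> l⋇·tol`. [folklore] -/
theorem mem_of_massThreshold_le_of_lt_cost (H : BridgeHyps P) {σ : Set (Fin ι.lstar × ι.VQ)} {tol : ℝ}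
    (hT : massThreshold P tol ≤ onTrivialMass P σ) {c : Fin ι.lstar × ι.VQ} (hc : (ι.lstar : ℝ) * tol < cellTrivialCost P c) : c ∈ σ :=
  mem_of_offTrivialMass_le_of_lt_cost H ((massThreshold_le_onTrivialMass_iff H σ tol).mp hT) hc

end Generic

/-! ## §2. At the genuine bed: the trivial cost in closed form -/

section Bed

variable {F : Type} [Field F] [NumberField F] (X : PilotData F) {logv : PadicLogs F} (hlog : LogvAnalytic logv)
  (M : Type) [Field M] [NumberField M]
  (archPk : ∀ (j : (thetaIndex X).Label) (vQ : (thetaIndex X).VQ), Set ((logShellsDH X logv).Packet j vQ))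
  (archSub : ∀ (j : (thetaIndex X).Label) (v : (thetaIndex X).V),
    Set ((logShellsDH X logv).Packet j ((thetaIndex X).over v)))
  (Ψ : ℤ → ∀ v : (thetaIndex X).V, v ∈ (thetaIndex X).Vbad → Set ((logShellsDH X logv).StarPacket v))
  (act : ℤ → ∀ v : (thetaIndex X).V, v ∈ (thetaIndex X).Vbad →
    (logShellsDH X logv).StarPacket v → Module.End ℚ ((logShellsDH X logv).StarPacket v))
  (Mmod : ℤ → ∀ j : (thetaIndex X).LabelStar, Set ((logShellsDH X logv).GlobalPacket j.1))
  (region : ℤ → ∀ j : (thetaIndex X).LabelStar, FinDivisor M → ∀ vQ : (thetaIndex X).VQ,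
    Set ((logShellsDH X logv).Packet j.1 vQ))
  (n : ℤ) {HT : Type} {LogLink : HT → HT → Type} {IsFull : ∀ {s t : HT}, LogLink s t → Prop}
  (lat : LGPGaussianLogThetaLattice LogLink IsFull)
  {Frd : Type} {IsoF : Frd → Frd → Type} {Ob : Frd → Type} {realify : Frd → Frd} {Strip : Type}
  {IsoS : Strip → Strip → Type} {Mv : ∀ v : (thetaIndex X).V, v ∈ (thetaIndex X).Vbad → Type}
  [∀ v h, Monoid (Mv v h)]
  (sig : GlobalLGPFrobenioidSignature (thetaIndex X).lstar (thetaIndex X).V (· ∈ (thetaIndex X).Vbad)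
    Frd IsoF Ob realify Strip IsoS Mv)
  (split : SplittingMonoids Mv) {ObΔ : Type} {N : ∀ v : (thetaIndex X).V, v ∈ (thetaIndex X).Vbad → Type}
  [∀ v h, Monoid (N v h)] (qData : QPilotData ObΔ N)
  (tq : ∀ (pp : Nat.Primes) (x : (thetaIndex X).Fibre (.inr pp)), haveI : Fact (pp : ℕ).Prime := ⟨pp.2⟩; kOf X pp.1 x)
  (t : ∀ (pp : Nat.Primes) (_ : Fin X.lstar) (x : (thetaIndex X).Fibre (.inr pp)),
    haveI : Fact (pp : ℕ).Prime := ⟨pp.2⟩; kOf X pp.1 x)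
  (htq0 : ∀ pp x, tq pp x ≠ 0)
  (htq1 : ∀ (pp : Nat.Primes) (x : (thetaIndex X).Fibre (.inr pp)),
    haveI : Fact (pp : ℕ).Prime := ⟨pp.2⟩; placeOf X pp.1 x ∉ X.S → ‖tq pp x‖ = 1)

/-- **THE TRIVIAL COST IN CLOSED FORM AT THE BED**: at abc-iut-c312-7's sharp print-normalised setting of any Dupuy–Hilado pilot datum, for REALISING
Θ- and q-ideles, the trivial cost of the prime cell `(i, p)` is `((i+1)² − 1)·(−qLocal_{i+1,p})` and of an archimedean cell `0` (q2-eq p472500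
`imageGap_thetaRegion3_inr/_inl`, restated for the NAMED cost). So `B_triv(σᶜ)` is the number MIN-SLICE (i) tabulates: `(1/l⋇)·Σ_{(j,p)∉σ}(j²−1)·|qLocal_p|`.
[cite: DupuyHilado2025, §3.3, Thm. 3.10.1] [claim: Mochizuki2012, status: disputed] -/
theorem cellTrivialCost_settingPrVolSharp_eq (ht0 : ∀ pp i x, t pp i x ≠ 0)
    (ht : ∀ (pp : Nat.Primes) (i : Fin X.lstar) (x : (thetaIndex X).Fibre (.inr pp)),
      haveI : Fact (pp : ℕ).Prime := ⟨pp.2⟩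
      Real.log ‖t pp i x‖ = -(X.thetaPilot i (placeOf X pp.1 x)) * logNorm F (placeOf X pp.1 x) / localDegree F (placeOf X pp.1 x))
    (htq : ∀ (pp : Nat.Primes) (x : (thetaIndex X).Fibre (.inr pp)),
      haveI : Fact (pp : ℕ).Prime := ⟨pp.2⟩
      Real.log ‖tq pp x‖ = -(X.qPilot (placeOf X pp.1 x)) * logNorm F (placeOf X pp.1 x) / localDegree F (placeOf X pp.1 x))
    (c : Fin (thetaIndex X).lstar × (thetaIndex X).VQ) :
    cellTrivialCost (settingPrVolSharp X hlog M archPk archSub Ψ act Mmod region n lat sig split qData tq t htq0 htq1) c =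
      Sum.elim (fun _ : Unit => (0 : ℝ))
        (fun pp : Nat.Primes => ((((c.1 : ℕ) : ℝ) + 1) ^ 2 - 1) *
          (-(settingPrVolSharp X hlog M archPk archSub Ψ act Mmod region n lat sig split qData tq t htq0 htq1).qLocal
            (labelSucc c.1) (.inr pp))) c.2 := by
  obtain ⟨i, vQ⟩ := c
  cases vQ with
  | inl u => exact imageGap_thetaRegion3_inl X hlog M archPk archSub Ψ act Mmod region n lat sig split qData tq t htq0 htq1 i u
  | inr pp => exact imageGap_thetaRegion3_inr X hlog M archPk archSub Ψ act Mmod region n lat sig split qData tq t htq0 htq1 ht0 ht htq i pp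

end Bed

/-! ## §3. (v2 append, abc-iut-rh2-T-1 2026-08-27) The BOUNDED-HEIGHT end: `B_triv(σᶜ) ≤ M`, so `M ≤ tol` clears the threshold for EVERY stratum -/

section BoundedHeight

variable {ι : ThetaIndex} {S : Situation ι} {P : Cor312.Setting S}

/-- **`B_triv(σᶜ) ≤ M`**: the discarded trivial mass never exceeds the total (the retained mass is `≥ 0`). [folklore] -/
theorem offTrivialMass_le_totalTrivialMass (H : BridgeHyps P) (σ : Set (Fin ι.lstar × ι.VQ)) :
    offTrivialMass P σ ≤ totalTrivialMass P := by
  rw [← onTrivialMass_add_offTrivialMass H σ]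
  linarith [onTrivialMass_nonneg (P := P) σ]

/-- **`mass(σ) ≤ M`**: the retained trivial mass never exceeds the total. [folklore] -/
theorem onTrivialMass_le_totalTrivialMass (H : BridgeHyps P) (σ : Set (Fin ι.lstar × ι.VQ)) :
    onTrivialMass P σ ≤ totalTrivialMass P := by
  rw [← onTrivialMass_add_offTrivialMass H σ]
  linarith [offTrivialMass_nonneg (P := P) σ]

/-- **THE BOUNDED-HEIGHT END (where «S on Σ ⟹ abc with print's constants» is empty of content): if the TOTAL trivial mass is already within the
tolerance, `M ≤ tol` — i.e. the threshold `T = M − tol ≤ 0` —, then `B_triv(σᶜ) ≤ tol` for EVERY stratum `σ`, the empty one included.** At the genuine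
bed `M = T.gap = ((l+1)/24 − 1/(2l))·log(q^{∤{2,l}})` (abc-iut-rh2-w-1) against `Tol(P,l) = 691200·d_mod·l(l+1)`: every TABULATED datum
(`log q ≪ 1.66·10⁷·d_mod·l`) is at this end (abc-iut-rh2-tab-2 2026-08-27T00:01:25Z: `θ(l) = T/M < 0` at every tabulated `l ≤ 1699`), which is how
the threshold hypothesis of the `Conditional/AbcOfSigmaMass*` endpoints is INHABITED there — honestly: by bounded height, not by licence mass. [folklore] -/
theorem offTrivialMass_le_of_totalTrivialMass_le (H : BridgeHyps P) {tol : ℝ} (hM : totalTrivialMass P ≤ tol)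
    (σ : Set (Fin ι.lstar × ι.VQ)) : offTrivialMass P σ ≤ tol :=
  (offTrivialMass_le_totalTrivialMass H σ).trans hM

/-- Threshold form: `massThreshold P tol ≤ 0` (⟺ `M ≤ tol`) ⟹ every stratum clears the threshold, `massThreshold P tol ≤ mass(σ)`. [folklore] -/
theorem massThreshold_le_onTrivialMass_of_nonpos {tol : ℝ} (hT : massThreshold P tol ≤ 0)
    (σ : Set (Fin ι.lstar × ι.VQ)) : massThreshold P tol ≤ onTrivialMass P σ :=
  hT.trans (onTrivialMass_nonneg σ)

/-- `massThreshold P tol ≤ 0 ⟺ M ≤ tol`. [folklore] -/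
theorem massThreshold_nonpos_iff (tol : ℝ) : massThreshold P tol ≤ 0 ↔ totalTrivialMass P ≤ tol := by
  unfold massThreshold
  constructor <;> intro h <;> linarith

/-- Conversely, ABOVE the bounded-height end the empty stratum fails: `tol < M` ⟹ `¬ B_triv(∅ᶜ) ≤ tol` — some licence mass is then genuinely needed
(how much: `M − tol`, `massThreshold_le_onTrivialMass_iff`). [folklore] -/
theorem not_offTrivialMass_empty_le_of_lt (tol : ℝ) (h : tol < totalTrivialMass P) : ¬ offTrivialMass P ∅ ≤ tol := by
  rw [offTrivialMass_empty]
  exact not_le.mpr h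

end BoundedHeight

end Summit.ABC.IUTFork.Repair.RH.SigmaMass

end
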